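import Mathlib
import Summits.ResolutionOfSingularities.ResolutionOfSingularities.Theorems.WeightedInvariantLocalWeightedDropNCBranchPrimesSwapReading

/-!
# `LocalWeightedDrop`, TOT2-LINE regime (P), piece (β-prime) — THE COUNT: #(u₁-graph data) + #(tangent u₂-graph data) ≤ #(primes `P ≠ 𝔪`
# with `monicGerm d A ∈ P^d`)

Crux item stmt-ResolutionOfSingularities-8899 `WeightedInvariant.LocalWeightedDrop` (route `ResolutionOfSingularities/WeightedInvariant`), ENGINE
skeleton v34 (80c4710965b6845c), registered stub `stub_regimePresented`, piece (P3) (res-type-088's conflict budget; NAMING res-type-088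
2026-08-27T16:46:34Z (3)/(4)).  [OURS · L1 W4.3 · chain w43 · seat res-L1-w43-stub-1 gen 6; def-free; assembles `…NCBranchPrimesReading` (u₁-graph
reading, injective), `…NCBranchPrimesSwapReading` (u₂-graph reading, injective, disjoint from the first on TANGENT data) and `…NCBranchPrimesFinite`;
nothing here is a statement of any manuscript; AI-produced, gate-checked, weaker than expert review.]

* **`ncard_graphData_add_ncard_tangentSwapGraphData_le`** — for a label `A : Fin d → k⟦u₁,u₂⟧` with squarefree germ (`d ≥ 2`, `k` perfect of
  characteristic `p`): `#{u₁-graph data h} + #{u₂-graph data g with g(0) = 0} ≤ #{P prime, P ≠ 𝔪, monicGerm d A ∈ P^d}` (all three sets finite).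
-/

set_option linter.dupNamespace false -- mandated namespace of this single-conjunct summit

noncomputable section

namespace Summit.ResolutionOfSingularities.ResolutionOfSingularities.Theorems

namespace NCBranchPrimes

open MvPowerSeries PolyDescent MonicDescent WildMonic NCPoly Literature.AlgebraicGeometry.Resolution

variable {k : Type} [Field k]

/-- **THE COUNT.**  The u₁-graph data and the tangent u₂-graph data of a label with squarefree germ read INJECTIVELY and DISJOINTLY into the finite
set of non-maximal primes `P` with `monicGerm d A ∈ P^d`; hence the inequality of cardinalities. -/
theorem ncard_graphData_add_ncard_tangentSwapGraphData_le (p : ℕ) [Fact p.Prime] [CharP k p] [PerfectRing k p] {d : ℕ} (hd : 2 ≤ d)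
    (A : Fin d → MvPowerSeries (Fin 2) k) (hsq : Squarefree (monicGerm d A)) :
    Set.ncard {h : MvPowerSeries (Fin 2) k | (∀ e : Fin 2 →₀ ℕ, e 1 ≠ 0 → coeff e h = 0) ∧
        ∃ ψ : MvPowerSeries (Fin 2) k, constantCoeff ψ = 0 ∧ IsPermissibleTwoT d (shift d (shearT h A) ψ)} +
      Set.ncard {g : MvPowerSeries (Fin 2) k | (∀ e : Fin 2 →₀ ℕ, e 1 ≠ 0 → coeff e g = 0) ∧ constantCoeff g = 0 ∧
        ∃ ψ : MvPowerSeries (Fin 2) k, constantCoeff ψ = 0 ∧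
          IsPermissibleTwoT d (shift d (shearT g (fun j => subst (![X 1, X 0] : Fin 2 → MvPowerSeries (Fin 2) k) (A j))) ψ)} ≤
      Set.ncard {P : Ideal (MvPowerSeries (Fin 3) k) | P.IsPrime ∧ P ≠ IsLocalRing.maximalIdeal (MvPowerSeries (Fin 3) k) ∧
        monicGerm d A ∈ P ^ d} := by
  classical
  -- names
  set D₁ := {h : MvPowerSeries (Fin 2) k | (∀ e : Fin 2 →₀ ℕ, e 1 ≠ 0 → coeff e h = 0) ∧
        ∃ ψ : MvPowerSeries (Fin 2) k, constantCoeff ψ = 0 ∧ IsPermissibleTwoT d (shift d (shearT h A) ψ)} with hD₁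
  set D₂ := {g : MvPowerSeries (Fin 2) k | (∀ e : Fin 2 →₀ ℕ, e 1 ≠ 0 → coeff e g = 0) ∧ constantCoeff g = 0 ∧
        ∃ ψ : MvPowerSeries (Fin 2) k, constantCoeff ψ = 0 ∧
          IsPermissibleTwoT d (shift d (shearT g (fun j => subst (![X 1, X 0] : Fin 2 → MvPowerSeries (Fin 2) k) (A j))) ψ)} with hD₂
  set PP := {P : Ideal (MvPowerSeries (Fin 3) k) | P.IsPrime ∧ P ≠ IsLocalRing.maximalIdeal (MvPowerSeries (Fin 3) k) ∧
        monicGerm d A ∈ P ^ d} with hPP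
  have hPPfin : PP.Finite := finite_primes_of_mem_pow p hsq hd
  have hD₁fin : D₁.Finite := finite_graphData p hd A hsq
  have hD₂fin : D₂.Finite := (finite_graphData_swap p hd A hsq).subset (fun g hg => ⟨hg.1, hg.2.2⟩)
  -- the two readings
  have hR₁ : ∀ h ∈ D₁, ∃ P : Ideal (MvPowerSeries (Fin 3) k), P.IsPrime ∧ P ≠ IsLocalRing.maximalIdeal (MvPowerSeries (Fin 3) k) ∧
      monicGerm d A ∈ P ^ d ∧ (X 1 - X 0 * rename (Fin.succAboveEmb (Fin.last 2)) h ∈ P) ∧ (X 0 ∉ P) ∧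
      (∀ G : MvPowerSeries (Fin 2) k, (∀ e : Fin 2 →₀ ℕ, e 1 ≠ 0 → coeff e G = 0) → rename (Fin.succAboveEmb (Fin.last 2)) G ∈ P → G = 0) := by
    rintro h ⟨hh, ψ, hψ, hperm⟩
    exact exists_prime_of_graphDatum A hh hψ hperm
  have hR₂ : ∀ g ∈ D₂, ∃ P : Ideal (MvPowerSeries (Fin 3) k), P.IsPrime ∧ P ≠ IsLocalRing.maximalIdeal (MvPowerSeries (Fin 3) k) ∧
      monicGerm d A ∈ P ^ d ∧
      (X 0 - X 1 * rename (Fin.succAboveEmb (Fin.last 2)) (subst (![X 1, X 0] : Fin 2 → MvPowerSeries (Fin 2) k) g) ∈ P) ∧ (X 1 ∉ P) ∧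
      (∀ G : MvPowerSeries (Fin 2) k, (∀ e : Fin 2 →₀ ℕ, e 1 ≠ 0 → coeff e G = 0) →
        rename (Fin.succAboveEmb (Fin.last 2)) (subst (![X 1, X 0] : Fin 2 → MvPowerSeries (Fin 2) k) G) ∈ P → G = 0) := by
    rintro g ⟨hg, -, ψ, hψ, hperm⟩
    exact exists_prime_of_swapGraphDatum A hg hψ hperm
  -- one function on the disjoint sum
  let f : MvPowerSeries (Fin 2) k ⊕ MvPowerSeries (Fin 2) k → Ideal (MvPowerSeries (Fin 3) k) :=
    Sum.elim (fun h => if hh : h ∈ D₁ then (hR₁ h hh).choose else ⊥) (fun g => if hg : g ∈ D₂ then (hR₂ g hg).choose else ⊥)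
  have hf₁ : ∀ h (hh : h ∈ D₁), f (Sum.inl h) = (hR₁ h hh).choose := fun h hh => by
    show (if hh : h ∈ D₁ then (hR₁ h hh).choose else ⊥) = _
    rw [dif_pos hh]
  have hf₂ : ∀ g (hg : g ∈ D₂), f (Sum.inr g) = (hR₂ g hg).choose := fun g hg => by
    show (if hg : g ∈ D₂ then (hR₂ g hg).choose else ⊥) = _
    rw [dif_pos hg]
  set s : Set (MvPowerSeries (Fin 2) k ⊕ MvPowerSeries (Fin 2) k) := Sum.inl '' D₁ ∪ Sum.inr '' D₂ with hs
  -- values in `PP`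
  have hfs : ∀ x ∈ s, f x ∈ PP := by
    rintro x (⟨h, hh, rfl⟩ | ⟨g, hg, rfl⟩)
    · rw [hf₁ h hh]
      obtain ⟨h1, h2, h3, -⟩ := (hR₁ h hh).choose_spec
      exact ⟨h1, h2, h3⟩
    · rw [hf₂ g hg]
      obtain ⟨h1, h2, h3, -⟩ := (hR₂ g hg).choose_spec
      exact ⟨h1, h2, h3⟩
  -- injectivity on `s`
  have hinj : Set.InjOn f s := by
    rintro x (⟨h, hh, rfl⟩ | ⟨g, hg, rfl⟩) y (⟨h', hh', rfl⟩ | ⟨g', hg', rfl⟩) hxy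
    · rw [hf₁ h hh, hf₁ h' hh'] at hxy
      obtain ⟨hP, -, -, hsub, hX0, hfix⟩ := (hR₁ h hh).choose_spec
      obtain ⟨-, -, -, hsub', -, -⟩ := (hR₁ h' hh').choose_spec
      rw [← hxy] at hsub'
      rw [eq_of_sub_mem_of_sub_mem hP hX0 hfix hh.1 hh'.1 hsub hsub']
    · exfalso
      rw [hf₁ h hh, hf₂ g' hg'] at hxy
      obtain ⟨-, -, -, hsub, -, -⟩ := (hR₁ h hh).choose_spec
      obtain ⟨-, -, -, hsub', hX1, -⟩ := (hR₂ g' hg').choose_spec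
      exact ne_of_readings (constantCoeff_rename_subst_swap hg'.2.1) hsub hsub' hX1 hxy
    · exfalso
      rw [hf₂ g hg, hf₁ h' hh'] at hxy
      obtain ⟨-, -, -, hsub, hX1, -⟩ := (hR₂ g hg).choose_spec
      obtain ⟨-, -, -, hsub', -, -⟩ := (hR₁ h' hh').choose_spec
      exact ne_of_readings (constantCoeff_rename_subst_swap hg.2.1) hsub' hsub hX1 hxy.symm
    · rw [hf₂ g hg, hf₂ g' hg'] at hxy
      obtain ⟨hP, -, -, hsub, hX1, hfix⟩ := (hR₂ g hg).choose_spec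
      obtain ⟨-, -, -, hsub', -, -⟩ := (hR₂ g' hg').choose_spec
      rw [← hxy] at hsub'
      rw [eq_of_sub_mem_of_sub_mem_swap hP hX1 hfix hg.1 hg'.1 hsub hsub']
  -- count
  have hcount : s.ncard = D₁.ncard + D₂.ncard := by
    rw [hs, Set.ncard_union_eq (Set.disjoint_left.mpr ?_) (hD₁fin.image _) (hD₂fin.image _),
      Set.ncard_image_of_injective _ Sum.inl_injective, Set.ncard_image_of_injective _ Sum.inr_injective]
    rintro x ⟨h, -, rfl⟩ ⟨g, -, hx⟩
    exact Sum.inr_ne_inl hx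
  rw [← hcount]
  exact Set.ncard_le_ncard_of_injOn f hfs hinj hPPfin

end NCBranchPrimes

end Summit.ResolutionOfSingularities.ResolutionOfSingularities.Theorems

end
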